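import Mathlib.NumberTheory.SmoothNumbers
import Mathlib.Analysis.SpecialFunctions.Pow.Real
import HarnessLib

/-!
# The canonical "smallest primes first" factorisation of a smooth number (Harper's `n = m n'`)

Topic `Literature/NumberTheory/Sieve`; a PROVED combinatorial tool file toward
`Literature.NumberTheory.DiophantineGeometry.XYZUpperHalf` ([Harper2016, Cor. 1]). In the proofs of
Theorem 1 (§3) and of Smooth Numbers Result 3 (§2.1) of op. cit., a `y`-smooth number `n > W` is
written *uniquely* as `n = m n'` "by revealing its prime factors one at a time, starting with the
smallest, until the product exceeds" `W`: then `W < m`, `m/P(m) ≤ W` (`P` = largest prime factor)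
and every prime factor of `n'` is `≥ P(m)`. We formalise this as a recursive function and prove the
exact regrouping of sums that Theorem 1 starts from:

* `canonPrefix n W` — `1` if `n ≤ 1`; `minFac n` if `W < minFac n`; else
  `minFac n · canonPrefix (n / minFac n) (W / minFac n)`; `lpf m = max m.primeFactors` (`P(m)`).
* `canonPrefix_spec` — for `1 ≤ W < n`: `1 < m ∣ n`, `W < m`, `m/lpf m ≤ W`, and the prime factors
  of `n/m` are `≥ lpf m`; `canonPrefix_mul_eq` — **uniqueness**: `canonPrefix (m n') W = m` whenever
  `m/lpf m ≤ W < m` and the prime factors of `n'` are `≥ lpf m`.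
* `sum_smooth_Ioc_eq_sum_sum` — **the exact decomposition**: for `1 ≤ W ≤ A` and any `f`,
  `∑_{A < n ≤ B, n ∈ S(y)} f(n) = ∑_{m ∈ 𝓜} ∑_{n' ∈ 𝓝(m)} f(m n')`,
  `𝓜 = {W < m ≤ W y : m ∈ S(y), m/lpf m ≤ W}`,
  `𝓝(m) = {1 ≤ n' ≤ B : n' ∈ S(y), (n' = 1 ∨ lpf m ≤ minFac n'), A < m n' ≤ B}`.

## References

* A. J. Harper, Compositio Math. 152 (2016) 1121–1158, §3 (first display) and §2.1 (proof of
  Smooth Numbers Result 3) [Harper2016].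
-/

open Finset

namespace Literature.NumberTheory.Sieve

/-! ### The largest prime factor -/

/-- The largest prime factor `P(m)` of `m` (`0` for `m ≤ 1`). [folklore] -/
def lpf (m : ℕ) : ℕ := m.primeFactors.sup id

/-- Every prime factor is `≤ P(m)`. [folklore] -/
theorem le_lpf_of_mem_primeFactors {m p : ℕ} (hp : p ∈ m.primeFactors) : p ≤ lpf m :=
  Finset.le_sup (f := id) hp

/-- A prime divisor of `m ≠ 0` is `≤ P(m)`. [folklore] -/
theorem le_lpf_of_prime_dvd {m p : ℕ} (hm : m ≠ 0) (hp : p.Prime) (hpm : p ∣ m) : p ≤ lpf m :=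
  le_lpf_of_mem_primeFactors (Nat.mem_primeFactors.mpr ⟨hp, hpm, hm⟩)

/-- For `m ≥ 2`, `P(m)` is a prime factor of `m`. [folklore] -/
theorem lpf_mem_primeFactors {m : ℕ} (hm : 1 < m) : lpf m ∈ m.primeFactors := by
  have hne : m.primeFactors.Nonempty := Nat.nonempty_primeFactors.mpr hm
  obtain ⟨p, hp, hsup⟩ := Finset.exists_mem_eq_sup _ hne id
  rw [lpf, hsup]; exact hp

/-- `P(m)` is prime (`m ≥ 2`). [folklore] -/
theorem lpf_prime {m : ℕ} (hm : 1 < m) : (lpf m).Prime :=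
  Nat.prime_of_mem_primeFactors (lpf_mem_primeFactors hm)

/-- `P(m) ∣ m` (`m ≥ 2`). [folklore] -/
theorem lpf_dvd {m : ℕ} (hm : 1 < m) : lpf m ∣ m :=
  Nat.dvd_of_mem_primeFactors (lpf_mem_primeFactors hm)

/-- `minFac m ≤ P(m)` (`m ≥ 2`). [folklore] -/
theorem minFac_le_lpf {m : ℕ} (hm : 1 < m) : m.minFac ≤ lpf m :=
  Nat.minFac_le_of_dvd (lpf_prime hm).two_le (lpf_dvd hm)

/-- `P(p) = p` for a prime `p`. [folklore] -/
theorem lpf_of_prime {p : ℕ} (hp : p.Prime) : lpf p = p := by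
  rw [lpf, Nat.Prime.primeFactors hp]; simp

/-- `P(ab) = max(P(a), P(b))` (`a, b ≠ 0`). [folklore] -/
theorem lpf_mul {a b : ℕ} (ha : a ≠ 0) (hb : b ≠ 0) : lpf (a * b) = max (lpf a) (lpf b) := by
  rw [lpf, Nat.primeFactors_mul ha hb, Finset.sup_union]; rfl

/-- `P(m) ≤ y` for a `y`-smooth `m` (`m ∈ smoothNumbers (y+1)`). [folklore] -/
theorem lpf_le_of_mem_smoothNumbers {m y : ℕ} (hm : m ∈ Nat.smoothNumbers (y + 1)) : lpf m ≤ y := by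
  rcases le_or_gt m 1 with h | h
  · have hm1 : m = 1 := by have := hm.1; omega
    subst hm1
    simp [lpf]
  · have hmem : lpf m ∈ m.primeFactorsList :=
      (Nat.mem_primeFactorsList (by omega)).mpr ⟨lpf_prime h, lpf_dvd h⟩
    exact Nat.lt_succ_iff.mp (hm.2 _ hmem)

/-- The quotient `m / P(m)` times `P(m)` is `m` (`m ≥ 2`). [folklore] -/
theorem div_lpf_mul_lpf {m : ℕ} (hm : 1 < m) : m / lpf m * lpf m = m :=
  Nat.div_mul_cancel (lpf_dvd hm)

/-! ### The canonical prefix -/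

/-- **The canonical smallest-primes prefix** of `n` at the threshold `W`: multiply the prime
factors of `n` one at a time, smallest first, until the product exceeds `W`.
[cite: Harper2016, §3 (first display: "by taking `m` to consist of the smallest prime factors")] -/
noncomputable def canonPrefix (n : ℕ) (W : ℝ) : ℕ :=
  if _h : n ≤ 1 then 1 else
    if W < n.minFac then n.minFac else n.minFac * canonPrefix (n / n.minFac) (W / n.minFac)
termination_by n
decreasing_by
  have hn : 1 < n := by omega
  exact Nat.div_lt_self (lt_trans zero_lt_one hn) (Nat.minFac_prime (ne_of_gt hn)).one_lt

/-- Unfolding: `n ≤ 1`. [folklore] -/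
theorem canonPrefix_of_le_one {n : ℕ} (W : ℝ) (h : n ≤ 1) : canonPrefix n W = 1 := by
  rw [canonPrefix, dif_pos h]

/-- Unfolding: `W < minFac n`. [folklore] -/
theorem canonPrefix_of_lt {n : ℕ} {W : ℝ} (h : 1 < n) (hW : W < n.minFac) :
    canonPrefix n W = n.minFac := by
  rw [canonPrefix, dif_neg (not_le.mpr h), if_pos hW]

/-- Unfolding: `minFac n ≤ W`. [folklore] -/
theorem canonPrefix_of_le {n : ℕ} {W : ℝ} (h : 1 < n) (hW : (n.minFac : ℝ) ≤ W) :
    canonPrefix n W = n.minFac * canonPrefix (n / n.minFac) (W / n.minFac) := by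
  rw [canonPrefix, dif_neg (not_le.mpr h), if_neg (not_lt.mpr hW)]

/-- `minFac` of a quotient of `n` is at least `minFac n`. [folklore] -/
theorem minFac_le_minFac_of_dvd {n d : ℕ} (hd : d ∣ n) (hd1 : d ≠ 1) (hn : n ≠ 0) :
    n.minFac ≤ d.minFac := by
  have hd0 : d ≠ 0 := by rintro rfl; simp at hd; exact hn hd
  exact Nat.minFac_le_of_dvd (Nat.minFac_prime hd1).two_le ((Nat.minFac_dvd d).trans hd)

/-- **The defining properties of the canonical prefix.** For `1 ≤ W < n`, with `m = canonPrefix n W`: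
`1 < m`, `m ∣ n`, `W < m`, `m/P(m) ≤ W`, and every prime factor of `n/m` is `≥ P(m)` (stated as
`n/m = 1 ∨ P(m) ≤ minFac (n/m)`). [cite: Harper2016, §3 (first display)] -/
theorem canonPrefix_spec : ∀ (n : ℕ) (W : ℝ), 1 ≤ W → W < n →
    1 < canonPrefix n W ∧ canonPrefix n W ∣ n ∧ W < canonPrefix n W ∧
      (((canonPrefix n W / lpf (canonPrefix n W) : ℕ) : ℝ) ≤ W) ∧
      (n / canonPrefix n W = 1 ∨ lpf (canonPrefix n W) ≤ (n / canonPrefix n W).minFac) := by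
  intro n
  induction n using Nat.strong_induction_on with
  | _ n ih =>
  intro W hW1 hWn
  have hn1 : 1 < n := by
    have : (1 : ℝ) < n := lt_of_le_of_lt hW1 hWn
    exact_mod_cast this
  have hn0 : n ≠ 0 := by omega
  set r := n.minFac with hr
  have hrp : r.Prime := Nat.minFac_prime (by omega)
  have hr1 : 1 < r := hrp.one_lt
  have hrn : r ∣ n := Nat.minFac_dvd n
  by_cases hcase : W < r
  · -- `m = minFac n`
    rw [canonPrefix_of_lt hn1 hcase]
    refine ⟨hr1, hrn, hcase, ?_, ?_⟩
    · rw [lpf_of_prime hrp, Nat.div_self hrp.pos]; simpa using hW1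
    · by_cases hq : n / r = 1
      · exact Or.inl hq
      · right
        rw [lpf_of_prime hrp]
        exact minFac_le_minFac_of_dvd (Nat.div_dvd_of_dvd hrn) hq hn0
  · -- `m = r · canonPrefix (n/r) (W/r)`
    push Not at hcase
    rw [canonPrefix_of_le hn1 hcase]
    set n' := n / r with hn'
    set W' := W / r with hW'
    have hr0 : (0 : ℝ) < r := by exact_mod_cast hrp.pos
    have hn'r : (n' : ℝ) = n / r := by rw [hn', Nat.cast_div hrn hr0.ne']
    have hn'lt : n' < n := Nat.div_lt_self (by omega) hr1
    have hW'1 : 1 ≤ W' := by rw [hW', le_div_iff₀ hr0]; linarith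
    have hW'n' : W' < n' := by rw [hW', hn'r]; exact div_lt_div_of_pos_right hWn hr0
    obtain ⟨h1, h2, h3, h4, h5⟩ := ih n' hn'lt W' hW'1 hW'n'
    set m' := canonPrefix n' W' with hm'
    have hm'0 : m' ≠ 0 := Nat.ne_zero_of_lt h1
    have hn'1 : 1 < n' := by
      have : (1 : ℝ) < n' := lt_of_le_of_lt hW'1 hW'n'
      exact_mod_cast this
    have hn'0 : n' ≠ 0 := Nat.ne_zero_of_lt hn'1
    -- the prime factors of `m'` are `≥ r`
    have hr_le_lpf : r ≤ lpf m' := by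
      calc r ≤ m'.minFac := minFac_le_minFac_of_dvd (h2.trans (Nat.div_dvd_of_dvd hrn)) (by omega) hn0
        _ ≤ lpf m' := minFac_le_lpf h1
    have hlpf : lpf (r * m') = lpf m' := by
      rw [lpf_mul hrp.ne_zero hm'0, lpf_of_prime hrp, max_eq_right hr_le_lpf]
    refine ⟨?_, ?_, ?_, ?_, ?_⟩
    · calc 1 < m' := h1
        _ ≤ r * m' := Nat.le_mul_of_pos_left _ hrp.pos
    · calc r * m' ∣ r * n' := Nat.mul_dvd_mul_left r h2
        _ = n := Nat.mul_div_cancel' hrn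
    · have hlt : (r : ℝ) * W' < r * m' := mul_lt_mul_of_pos_left h3 hr0
      have hWeq : W = r * W' := by rw [hW']; field_simp
      push_cast
      linarith
    · rw [hlpf]
      have hdiv : r * m' / lpf m' = r * (m' / lpf m') := Nat.mul_div_assoc r (lpf_dvd h1)
      rw [hdiv, Nat.cast_mul]
      calc (r : ℝ) * ((m' / lpf m' : ℕ) : ℝ) ≤ r * W' := mul_le_mul_of_nonneg_left h4 hr0.le
        _ = W := by rw [hW']; field_simp
    · have hquot : n / (r * m') = n' / m' := by
        rw [hn', Nat.div_div_eq_div_mul]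
      rw [hquot, hlpf]
      exact h5

/-- **Uniqueness of the canonical factorisation.** If `1 < m`, `m/P(m) ≤ W < m`, `n' ≠ 0` and every
prime factor of `n'` is `≥ P(m)` (`n' = 1 ∨ P(m) ≤ minFac n'`), then `canonPrefix (m n') W = m`.
[cite: Harper2016, §3 ("has a unique decomposition in the form `mn`")] -/
theorem canonPrefix_mul_eq : ∀ (m : ℕ), 1 < m → ∀ (n' : ℕ) (W : ℝ), n' ≠ 0 →
    (((m / lpf m : ℕ) : ℝ) ≤ W) → W < m → (n' = 1 ∨ lpf m ≤ n'.minFac) →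
    canonPrefix (m * n') W = m := by
  intro m
  induction m using Nat.strong_induction_on with
  | _ m ih =>
  intro hm1 n' W hn'0 hmW hWm hn'
  have hm0 : m ≠ 0 := by omega
  set r := m.minFac with hr
  have hrp : r.Prime := Nat.minFac_prime (by omega)
  have hr1 : 1 < r := hrp.one_lt
  have hrm : r ∣ m := Nat.minFac_dvd m
  have hr0 : (0 : ℝ) < r := by exact_mod_cast hrp.pos
  have hmn1 : 1 < m * n' := by
    calc 1 < m := hm1
      _ ≤ m * n' := Nat.le_mul_of_pos_right _ (Nat.pos_of_ne_zero hn'0)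
  -- `minFac (m n') = r`
  have hminFac : (m * n').minFac = r := by
    apply le_antisymm
    · exact Nat.minFac_le_of_dvd hrp.two_le (hrm.trans (Dvd.intro _ rfl))
    · set s := (m * n').minFac with hs
      have hsp : s.Prime := Nat.minFac_prime (by omega)
      have hsd : s ∣ m * n' := Nat.minFac_dvd _
      rcases (Nat.Prime.dvd_mul hsp).mp hsd with h | h
      · exact Nat.minFac_le_of_dvd hsp.two_le h
      · rcases hn' with h1 | h1
        · subst h1; exact absurd (Nat.eq_one_of_dvd_one h ▸ hsp) Nat.not_prime_one
        · calc r ≤ lpf m := minFac_le_lpf hm1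
            _ ≤ n'.minFac := h1
            _ ≤ s := Nat.minFac_le_of_dvd hsp.two_le h
  by_cases hcase : W < r
  · -- `W < minFac m`: then `m` is the prime `r`
    rw [canonPrefix_of_lt hmn1 (by rw [hminFac]; exact hcase), hminFac]
    -- `d = m / lpf m` is `1`
    set d := m / lpf m with hd
    have hdm : d ∣ m := Nat.div_dvd_of_dvd (lpf_dvd hm1)
    by_cases hd1 : d = 1
    · have hmeq : m = lpf m := by
        have := div_lpf_mul_lpf hm1
        rw [← hd, hd1, one_mul] at this
        exact this.symm
      have hmp : m.Prime := by rw [hmeq]; exact lpf_prime hm1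
      rw [hr, Nat.Prime.minFac_eq hmp]
    · exfalso
      have h1 : r ≤ d.minFac := minFac_le_minFac_of_dvd hdm hd1 hm0
      have hd0 : d ≠ 0 := by
        rintro h0; rw [h0] at hdm; simp at hdm; exact hm0 hdm
      have h2 : d.minFac ≤ d := Nat.minFac_le (Nat.pos_of_ne_zero hd0)
      have : (r : ℝ) ≤ d := by exact_mod_cast h1.trans h2
      linarith
  · push Not at hcase
    rw [canonPrefix_of_le hmn1 (by rw [hminFac]; exact hcase), hminFac]
    set m₁ := m / r with hm₁
    have hmul : m * n' / r = m₁ * n' := Nat.mul_div_right_comm hrm n'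
    rw [hmul]
    have hm₁0 : m₁ ≠ 0 := by
      intro h0
      have := Nat.div_mul_cancel hrm
      rw [← hm₁, h0, zero_mul] at this
      exact hm0 this.symm
    have hm₁1 : m₁ ≠ 1 := by
      intro h1
      have : m = r := by
        have := Nat.div_mul_cancel hrm
        rw [← hm₁, h1, one_mul] at this
        exact this.symm
      rw [this] at hWm
      linarith
    have hm₁gt : 1 < m₁ := lt_of_le_of_ne (Nat.pos_of_ne_zero hm₁0) (Ne.symm hm₁1)
    have hm₁lt : m₁ < m := Nat.div_lt_self (by omega) hr1
    have hmr : m = r * m₁ := by rw [hm₁, Nat.mul_div_cancel' hrm]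
    -- `lpf m₁ = lpf m`
    have hr_le : r ≤ lpf m₁ := by
      calc r ≤ m₁.minFac := minFac_le_minFac_of_dvd (Nat.div_dvd_of_dvd hrm) hm₁1 hm0
        _ ≤ lpf m₁ := minFac_le_lpf hm₁gt
    have hlpf : lpf m = lpf m₁ := by
      rw [hmr, lpf_mul hrp.ne_zero hm₁0, lpf_of_prime hrp, max_eq_right hr_le]
    -- hypotheses of the induction
    have hdiv : ((m₁ / lpf m₁ : ℕ) : ℝ) ≤ W / r := by
      rw [le_div_iff₀ hr0]
      have h1 : m / lpf m = r * (m₁ / lpf m₁) := by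
        rw [hlpf, hmr]; exact Nat.mul_div_assoc r (lpf_dvd hm₁gt)
      have h2 : ((m / lpf m : ℕ) : ℝ) = r * ((m₁ / lpf m₁ : ℕ) : ℝ) := by rw [h1]; push_cast; ring
      nlinarith
    have hWm₁ : W / r < m₁ := by
      rw [div_lt_iff₀ hr0]
      calc W < m := hWm
        _ = m₁ * r := by rw [hmr]; push_cast; ring
    have hn'₁ : n' = 1 ∨ lpf m₁ ≤ n'.minFac := by rwa [← hlpf]
    rw [ih m₁ hm₁lt hm₁gt n' (W / r) hn'0 hdiv hWm₁ hn'₁, ← hmr]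

/-! ### The exact decomposition of a sum over smooth numbers -/

section Decomposition

variable {M : Type*} [AddCommMonoid M]

/-- The set `𝓜 = {W < m ≤ W y : m ∈ S(y), m/P(m) ≤ W}` of admissible prefixes.
[cite: Harper2016, §3 (first display)] -/
noncomputable def prefixSet (y : ℕ) (W : ℝ) : Finset ℕ :=
  (Finset.Ioc ⌊W⌋₊ ⌊W * y⌋₊).filter
    (fun m => m ∈ Nat.smoothNumbers (y + 1) ∧ ((m / lpf m : ℕ) : ℝ) ≤ W)

/-- The set `𝓝(m) = {1 ≤ n' ≤ B : n' ∈ S(y), (n' = 1 ∨ P(m) ≤ minFac n'), A < m n' ≤ B}` of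
admissible cofactors. [cite: Harper2016, §3 (first display)] -/
noncomputable def cofactorSet (y : ℕ) (A B : ℝ) (m : ℕ) : Finset ℕ :=
  (Finset.Icc 1 ⌊B⌋₊).filter (fun n' => n' ∈ Nat.smoothNumbers (y + 1) ∧
    (n' = 1 ∨ lpf m ≤ n'.minFac) ∧ A < (m : ℝ) * n' ∧ (m : ℝ) * n' ≤ B)

/-- Membership in `𝓜`. [folklore] -/
theorem mem_prefixSet {y : ℕ} {W : ℝ} (hW : 0 ≤ W) {m : ℕ} :
    m ∈ prefixSet y W ↔ W < m ∧ (m : ℝ) ≤ W * y ∧ m ∈ Nat.smoothNumbers (y + 1) ∧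
      ((m / lpf m : ℕ) : ℝ) ≤ W := by
  rw [prefixSet, Finset.mem_filter, Finset.mem_Ioc, Nat.floor_lt hW, Nat.le_floor_iff (by positivity)]
  tauto

/-- Membership in `𝓝(m)`. [folklore] -/
theorem mem_cofactorSet {y : ℕ} {A B : ℝ} (hB : 0 ≤ B) {m n' : ℕ} :
    n' ∈ cofactorSet y A B m ↔ 1 ≤ n' ∧ (n' : ℝ) ≤ B ∧ n' ∈ Nat.smoothNumbers (y + 1) ∧
      (n' = 1 ∨ lpf m ≤ n'.minFac) ∧ A < (m : ℝ) * n' ∧ (m : ℝ) * n' ≤ B := by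
  rw [cofactorSet, Finset.mem_filter, Finset.mem_Icc, Nat.le_floor_iff hB]
  tauto

/-- **The exact decomposition** (Harper §3, first display): for `1 ≤ W ≤ A` and any `f`,
`∑_{A < n ≤ B, n ∈ S(y)} f(n) = ∑_{m ∈ 𝓜} ∑_{n' ∈ 𝓝(m)} f(m n')` — every `y`-smooth `n ∈ (A, B]`
is `m n'` for exactly one admissible pair (`m = canonPrefix n W`).
[cite: Harper2016, §3 (first display)] -/
theorem sum_smooth_Ioc_eq_sum_sum {y : ℕ} {W A B : ℝ} (hW1 : 1 ≤ W) (hWA : W ≤ A) (hAB : A ≤ B)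
    (f : ℕ → M) :
    ∑ n ∈ (Finset.Ioc ⌊A⌋₊ ⌊B⌋₊).filter (· ∈ Nat.smoothNumbers (y + 1)), f n =
      ∑ m ∈ prefixSet y W, ∑ n' ∈ cofactorSet y A B m, f (m * n') := by
  classical
  have hW0 : 0 ≤ W := by linarith
  have hA0 : 0 ≤ A := by linarith
  have hB0 : 0 ≤ B := by linarith
  set S := (prefixSet y W).sigma (cofactorSet y A B) with hS
  set g : (Σ _ : ℕ, ℕ) → ℕ := fun σ => σ.1 * σ.2 with hg
  -- injectivity of `(m, n') ↦ m n'`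
  have hinj : Set.InjOn g ↑S := by
    rintro ⟨m₁, n₁⟩ h₁ ⟨m₂, n₂⟩ h₂ heq
    rw [Finset.mem_coe, hS, Finset.mem_sigma] at h₁ h₂
    obtain ⟨hm₁, hn₁⟩ := h₁
    obtain ⟨hm₂, hn₂⟩ := h₂
    rw [mem_prefixSet hW0] at hm₁ hm₂
    rw [mem_cofactorSet hB0] at hn₁ hn₂
    simp only [hg] at heq
    have hc₁ := canonPrefix_mul_eq m₁ (by have : (1:ℝ) < m₁ := lt_of_le_of_lt hW1 hm₁.1; exact_mod_cast this)
      n₁ W (Nat.one_le_iff_ne_zero.mp hn₁.1) hm₁.2.2.2 hm₁.1 hn₁.2.2.2.1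
    have hc₂ := canonPrefix_mul_eq m₂ (by have : (1:ℝ) < m₂ := lt_of_le_of_lt hW1 hm₂.1; exact_mod_cast this)
      n₂ W (Nat.one_le_iff_ne_zero.mp hn₂.1) hm₂.2.2.2 hm₂.1 hn₂.2.2.2.1
    have hm : m₁ = m₂ := by rw [← hc₁, ← hc₂, heq]
    subst hm
    have hm0 : 0 < m₁ := by have : (0:ℝ) < m₁ := lt_of_le_of_lt hW0 hm₁.1; exact_mod_cast this
    have hn : n₁ = n₂ := Nat.eq_of_mul_eq_mul_left hm0 heq
    subst hn
    rfl
  -- the image is the set of smooth `n ∈ (A, B]`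
  have himage : S.image g = (Finset.Ioc ⌊A⌋₊ ⌊B⌋₊).filter (· ∈ Nat.smoothNumbers (y + 1)) := by
    ext n
    rw [Finset.mem_image, Finset.mem_filter, Finset.mem_Ioc, Nat.floor_lt hA0, Nat.le_floor_iff hB0]
    constructor
    · rintro ⟨⟨m, n'⟩, hσ, rfl⟩
      rw [hS, Finset.mem_sigma, mem_prefixSet hW0, mem_cofactorSet hB0] at hσ
      obtain ⟨⟨-, -, hmS, -⟩, ⟨-, -, hn'S, -, hA', hB'⟩⟩ := hσ
      simp only [hg]
      push_cast
      exact ⟨⟨hA', hB'⟩, Nat.mul_mem_smoothNumbers hmS hn'S⟩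
    · rintro ⟨⟨hAn, hnB⟩, hnS⟩
      have hWn : W < n := lt_of_le_of_lt hWA hAn
      obtain ⟨h1, h2, h3, h4, h5⟩ := canonPrefix_spec n W hW1 hWn
      set m := canonPrefix n W with hm
      have hn0 : n ≠ 0 := hnS.1
      have hmS : m ∈ Nat.smoothNumbers (y + 1) := Nat.mem_smoothNumbers_of_dvd hnS h2
      have hmn : m * (n / m) = n := Nat.mul_div_cancel' h2
      refine ⟨⟨m, n / m⟩, ?_, by simp only [hg]; exact hmn⟩
      rw [hS, Finset.mem_sigma, mem_prefixSet hW0, mem_cofactorSet hB0]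
      have hcast : ((m : ℝ)) * ((n / m : ℕ) : ℝ) = n := by exact_mod_cast hmn
      refine ⟨⟨h3, ?_, hmS, h4⟩, ⟨?_, ?_, Nat.mem_smoothNumbers_of_dvd hnS (Nat.div_dvd_of_dvd h2), h5,
        by rw [hcast]; exact hAn, by rw [hcast]; exact hnB⟩⟩
      · -- `m = (m/lpf m) · lpf m ≤ W y`
        have hl : (lpf m : ℝ) ≤ y := by exact_mod_cast lpf_le_of_mem_smoothNumbers hmS
        calc (m : ℝ) = ((m / lpf m : ℕ) : ℝ) * lpf m := by exact_mod_cast (div_lpf_mul_lpf h1).symm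
          _ ≤ W * y := mul_le_mul h4 hl (Nat.cast_nonneg _) hW0
      · exact Nat.div_pos (Nat.le_of_dvd (Nat.pos_of_ne_zero hn0) h2) (by omega)
      · calc ((n / m : ℕ) : ℝ) ≤ n := by exact_mod_cast Nat.div_le_self n m
          _ ≤ B := hnB
  rw [← himage, Finset.sum_image hinj, hS, Finset.sum_sigma]

end Decomposition

end Literature.NumberTheory.Sieve
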